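import Summits.QuantumAdvantage.QuantumAdvantage.Theorems.LinnikCubicClassGroupsDegreeOnePrimesEscapeResidueHadamard
import Summits.QuantumAdvantage.QuantumAdvantage.Theorems.LinnikCubicClassGroupsDegreeOnePrimesEscapeResidueInputs
import HarnessLib

/-!
# Stark's lower bound for the residue of `ζ_K` from a real-zero-free interval (Stark 1974, Lemma 4)

Topic `Summits/QuantumAdvantage/QuantumAdvantage/Theorems`, helper for the crux `DegreeOnePrimesEscape`
(stmt-QuantumAdvantage-11543) of route `LinnikCubicClassGroups`; cell B2b-1 (linnik-cubic), PART B — the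
residue lower bound R of line `subgroup-orthogonality-escape` (`ResidueLowerBound`), which feeds the size
parameter `P ≥ κ_K⁻¹` of the log-free zero-density estimates. HONEST FRAMING: the value of this file is a
THEOREM — not summit progress.

`residue_ge_of_zeroFree` — **Stark's Lemma 4** [Stark1974, Lemma 4 / (27)]: if `[K:ℚ] = n ≥ 2`,
`0 < c ≤ ¼` and `ζ_K(σ) ≠ 0` for `1 − c/log|d_K| ≤ σ < 1`, then `κ_K ≥ e^{−7} · 16^{−n} · c / log|d_K|`.
Proof as in Stark: with `ξ_K(s) = s(s−1)Λ_K(s)` (`exists_starkXi`), `δ = 1/(4 log|d_K|)`, `σ₁ = 1 + δ`,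
divide out the (at most one, real, simple: `Stark1974_atMostOneZero_holds`) zero `β₀` of `ζ_K` in Stark's box
together with `1 − β₀`, compare `Re F₂'/F₂(σ) ≤ 4 Re F₂'/F₂(σ₁) ≤ 4(1/δ + ½ log|d_K|)`
(`Residue.re_logDeriv_le_four_mul`, `re_logDeriv_xi_le`), integrate from `1` to `σ₁`
(`Residue.log_norm_sub_le`), and unpack `ξ(1) = κ_K γ_K(1)`, `|ξ(σ₁)| ≥ δ |γ_K(σ₁)|`,
`|γ_K(σ₁)| ≥ 16^{−n} |γ_K(1)|` (`norm_dedekindGammaFactor_ge`), `1 − β₀ > c/log|d_K|`.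

## References

* H. M. Stark, *Some effective cases of the Brauer–Siegel theorem*, Invent. Math. 23 (1974)
  135–152, Lemma 4 and formula (27). [Stark1974]
-/

noncomputable section

open Complex Filter Topology Set NumberField NumberField.InfinitePlace
open scoped ComplexOrder

namespace Summit.QuantumAdvantage.QuantumAdvantage.Theorems.DegreeOnePrimesEscape

namespace Residue

open Literature.NumberTheory.LFunctions Literature.NumberTheory.LFunctions.NumberField
  Literature.NumberTheory.LFunctions.Stark1974

/-! ### Stark's Lemma 4 -/

set_option maxHeartbeats 800000 in
/-- **Stark's lower bound for the residue from a real-zero-free interval** [Stark1974, Lemma 4 /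
(27)]: for a number field `K` of degree `n ≥ 2`, if `0 < c ≤ ¼` and `ζ_K(σ) ≠ 0` for all real `σ`
with `1 − c/log|d_K| ≤ σ < 1`, then `κ_K ≥ e^{−7} · 16^{−n} · c/log|d_K|`.
[cite: Stark1974, Lemma 4] -/
theorem residue_ge_of_zeroFree (K : Type) [Field K] [NumberField K] (hn : 1 < Module.finrank ℚ K)
    {c : ℝ} (hc : 0 < c) (hc4 : c ≤ 1 / 4)
    (hZ : ∀ σ : ℝ, 1 - c / Real.log ((discr K).natAbs : ℝ) ≤ σ → σ < 1 → dedekindZetaCont K σ ≠ 0) :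
    Real.exp (-7) * (1 / 16 : ℝ) ^ Module.finrank ℚ K * (c / Real.log ((discr K).natAbs : ℝ)) ≤
      dedekindZeta_residue K := by
  classical
  -- sizes
  set d : ℝ := ((discr K).natAbs : ℝ) with hd
  have hd3 : (3 : ℝ) ≤ d := by
    have h2 := NumberField.abs_discr_gt_two hn
    rw [hd, Nat.cast_natAbs]
    exact_mod_cast (show (3 : ℤ) ≤ |discr K| by omega)
  set L : ℝ := Real.log d with hL
  have hL1 : 1 < L := by
    rw [hL, Real.lt_log_iff_exp_lt (by linarith)]
    have := Real.exp_one_lt_d9; linarith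
  have hL0 : 0 < L := by linarith
  set δ : ℝ := 1 / (4 * L) with hδ
  have hδ0 : 0 < δ := by rw [hδ]; positivity
  have hδ4 : δ ≤ 1 / 4 := by
    rw [hδ, div_le_div_iff₀ (by positivity) (by norm_num)]; nlinarith
  have hδL : δ * L = 1 / 4 := by rw [hδ]; field_simp
  set σ₁ : ℝ := 1 + δ with hσ₁
  have hσ₁1 : 1 < σ₁ := by rw [hσ₁]; linarith
  have hσ₁2 : σ₁ ≤ 2 := by rw [hσ₁]; linarith
  -- Stark's completion `ξ_K`
  obtain ⟨ξ, hdiff, hsymm, ⟨C, hC⟩, hpos⟩ := exists_starkXi K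
  obtain ⟨C', hC'0, hC'⟩ : ∃ C' : ℝ, 0 ≤ C' ∧ ∀ s, ‖ξ s‖ ≤ C' * Real.exp (‖s‖ ^ (15 / 8 : ℝ)) :=
    ⟨max C 0, le_max_right _ _, fun s ↦ (hC s).trans
      (mul_le_mul_of_nonneg_right (le_max_left _ _) (Real.exp_pos _).le)⟩
  have hzeroξ : ∀ s, ξ s = 0 → s.re ≤ 1 := fun s hs ↦ (xi_zero hsymm hpos hs).2.1.le
  -- Stark's box and the open box `{Re s > 1 − δ, |Im s| < δ}`
  obtain ⟨hsub, hsimple⟩ := Stark1974_atMostOneZero_holds K hn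
  have hboxsub : ∀ s : ℂ, 1 - δ < s.re → |s.im| < δ → s ∈ starkBox d := by
    intro s h1 h2
    rw [mem_starkBox_iff]
    exact ⟨by rw [← hL, ← hδ]; linarith, by rw [← hL, ← hδ]; exact h2.le⟩
  -- a zero of `ξ` in the open box is a zero of `ζ₁_K` in Stark's box
  have hξbox : ∀ s : ℂ, ξ s = 0 → 1 - δ < s.re → |s.im| < δ →
      dedekindZeta₁ K s = 0 ∧ s ∈ starkBox d := fun s hs h1 h2 ↦
    ⟨(xi_zero hsymm hpos hs).2.2, hboxsub s h1 h2⟩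
  -- `Re ξ'/ξ(σ₁) ≤ 1/δ + L/2`
  have hξ'σ₁ : (logDeriv ξ σ₁).re ≤ 1 / (σ₁ - 1) + L / 2 := by
    have := re_logDeriv_xi_le hpos hn hσ₁1 hσ₁2
    rw [hL, hd]; simpa using this
  have h1δ : 1 / (σ₁ - 1) = 1 / δ := by rw [hσ₁]; ring_nf
  -- the values of `ξ` at `1` and `σ₁`
  have hξ1 : ‖ξ 1‖ = dedekindZeta_residue K * ‖dedekindGammaFactor K 1‖ := by
    rw [hpos 1 (by simp), one_mul, norm_mul, dedekindZeta₁_apply_one, Complex.norm_real,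
      Real.norm_of_nonneg (dedekindZeta_residue_pos K).le]
  have hξσ₁ : δ * ‖dedekindGammaFactor K σ₁‖ ≤ ‖ξ σ₁‖ := by
    rw [hpos σ₁ (by simp; linarith), norm_mul, norm_mul, Complex.norm_real, Real.norm_of_nonneg (by linarith)]
    have h1 : δ ≤ ‖dedekindZeta₁ K σ₁‖ := by
      have := sub_one_le_norm_dedekindZeta₁ K hσ₁1; rw [hσ₁] at this ⊢; linarith
    have hγ0 : 0 ≤ ‖dedekindGammaFactor K σ₁‖ := norm_nonneg _
    calc δ * ‖dedekindGammaFactor K ↑σ₁‖ ≤ (σ₁ * ‖dedekindZeta₁ K σ₁‖) * ‖dedekindGammaFactor K σ₁‖ := by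
          apply mul_le_mul_of_nonneg_right _ hγ0
          calc δ ≤ ‖dedekindZeta₁ K σ₁‖ := h1
            _ ≤ σ₁ * ‖dedekindZeta₁ K σ₁‖ := le_mul_of_one_le_left (norm_nonneg _) hσ₁1.le
      _ = σ₁ * ‖dedekindZeta₁ K ↑σ₁‖ * ‖dedekindGammaFactor K ↑σ₁‖ := by ring
  have hγ : (1 / 16 : ℝ) ^ Module.finrank ℚ K * ‖dedekindGammaFactor K 1‖ ≤ ‖dedekindGammaFactor K σ₁‖ :=
    norm_dedekindGammaFactor_ge K hσ₁1.le hσ₁2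
  have hγ1pos : 0 < ‖dedekindGammaFactor K 1‖ :=
    norm_pos_iff.mpr (dedekindGammaFactor_ne_zero_of_re_pos (by simp))
  have hκ0 : 0 < dedekindZeta_residue K := dedekindZeta_residue_pos K
  set E : ℝ := (1 / 16 : ℝ) ^ Module.finrank ℚ K with hE
  have hE0 : 0 < E := by rw [hE]; positivity
  -- the target in the form `κ ‖γ(1)‖ ≥ A · δ ‖γ(σ₁)‖`-type bounds
  -- MAIN CLAIM: `‖ξ 1‖ ≥ (3/10) e^{-9/2} (c/L) / δ · ‖ξ σ₁‖` (with room: both cases)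
  have hmain : 3 / 10 * Real.exp (-9 / 2) * (c / L) / δ * ‖ξ σ₁‖ ≤ ‖ξ 1‖ := by
    by_cases hex : ∃ ρ : ℂ, dedekindZeta₁ K ρ = 0 ∧ ρ ∈ starkBox d
    · -- CASE (ii): an exceptional zero `β₀` in Stark's box (real, simple, unique)
      obtain ⟨ρ₀, hρ₀, hρ₀box⟩ := hex
      obtain ⟨hρ₀im, hρ₀ord⟩ := hsimple ρ₀ hρ₀ hρ₀box
      set β₀ : ℝ := ρ₀.re with hβ₀
      have hρ₀eq : ρ₀ = (β₀ : ℂ) := Complex.ext (by simp [hβ₀]) (by simp [hρ₀im])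
      have hβ₀ge : 1 - δ ≤ β₀ := by
        have := (mem_starkBox_iff d ρ₀).mp hρ₀box; rw [← hL, ← hδ] at this; exact this.1
      have hβ₀lt1 : β₀ < 1 := by
        by_contra h; rw [not_lt] at h
        exact dedekindZeta₁_ne_zero_of_one_le_re (K := K) (s := ρ₀) (by rw [← hβ₀]; exact h) hρ₀
      have hβ₀pos : 0 < β₀ := by linarith
      -- Stark's hypothesis: `β₀ < 1 − c/L`
      have hβ₀c : β₀ < 1 - c / L := by
        by_contra h; rw [not_lt] at h
        have hz : dedekindZetaCont K β₀ = 0 := by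
          have h1 : dedekindZeta₁ K β₀ = 0 := by rw [← hρ₀eq]; exact hρ₀
          rw [dedekindZeta₁_apply_of_ne_one (by
            intro h'; have := congrArg Complex.re h'; simp at this; linarith)] at h1
          rcases mul_eq_zero.mp h1 with h2 | h2
          · exfalso; have := congrArg Complex.re h2; simp at this; linarith
          · exact h2
        exact hZ β₀ h hβ₀lt1 hz
      have hcL : c / L < 1 - β₀ := by linarith
      -- the multiset `T = {β₀, 1 − β₀}` and the division `ξ = P_T · F₂`
      set T : Multiset ℂ := {(β₀ : ℂ), ((1 - β₀ : ℝ) : ℂ)} with hT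
      have hordξ : analyticOrderAt ξ (β₀ : ℂ) = 1 := by
        rw [analyticOrderAt_xi_eq hpos (by simp; exact hβ₀pos), ← hρ₀eq, hρ₀ord]
      have hordξ' : analyticOrderAt ξ ((1 - β₀ : ℝ) : ℂ) = 1 := by
        rw [show ((1 - β₀ : ℝ) : ℂ) = 1 - (β₀ : ℂ) by push_cast; ring, analyticOrderAt_one_sub hsymm, hordξ]
      have hne2 : (β₀ : ℂ) ≠ ((1 - β₀ : ℝ) : ℂ) := by
        intro h; have := congrArg Complex.re h; simp at this; linarith
      have hTcount : ∀ z, (T.count z : ℕ∞) ≤ analyticOrderAt ξ z := by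
        intro z
        by_cases hz1 : z = (β₀ : ℂ)
        · subst hz1
          rw [hT, Multiset.insert_eq_cons, Multiset.count_cons_self, Multiset.count_singleton,
            if_neg hne2, hordξ]; norm_num
        · by_cases hz2 : z = ((1 - β₀ : ℝ) : ℂ)
          · subst hz2
            rw [hT, Multiset.insert_eq_cons, Multiset.count_cons_of_ne hne2.symm,
              Multiset.count_singleton_self, hordξ']; norm_num
          · rw [hT, Multiset.insert_eq_cons, Multiset.count_cons_of_ne hz1, Multiset.count_singleton,
              if_neg hz2]; simp
      obtain ⟨F₂, hF₂, heq⟩ := exists_eq_rootProd_mul T hdiff hTcount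
      have hP : ∀ s : ℂ, (T.map (fun ρ ↦ s - ρ)).prod = (s - β₀) * (s - ((1 - β₀ : ℝ) : ℂ)) := by
        intro s; rw [hT, Multiset.insert_eq_cons, Multiset.map_cons, Multiset.prod_cons,
          Multiset.map_singleton, Multiset.prod_singleton]
      have heq' : ∀ s, ξ s = (s - β₀) * (s - ((1 - β₀ : ℝ) : ℂ)) * F₂ s := fun s ↦ by rw [heq s, hP s]
      -- symmetry and growth of `F₂`
      have hTsymm : T.map (fun ρ ↦ 1 - ρ) = T := by
        simp only [hT, Multiset.insert_eq_cons, Multiset.map_cons, Multiset.map_singleton]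
        rw [show (1 : ℂ) - (β₀ : ℂ) = ((1 - β₀ : ℝ) : ℂ) by push_cast; ring,
          show (1 : ℂ) - ((1 - β₀ : ℝ) : ℂ) = (β₀ : ℂ) by push_cast; ring]
        exact Multiset.cons_swap _ _ _
      have hF₂symm : ∀ s, F₂ (1 - s) = F₂ s := by
        intro s
        have h := one_sub_eq_of_rootProd_mul hTsymm hsymm hF₂ heq s
        rw [hT, Multiset.insert_eq_cons, Multiset.card_cons, Multiset.card_singleton] at h
        simpa using h
      obtain ⟨C₂, hC₂0, hC₂⟩ := growth_of_eq_rootProd_mul T hF₂ heq hC'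
      -- zeros of `F₂`
      have hF₂zero : ∀ s, F₂ s = 0 → s.re ≤ 1 := fun s hs ↦ hzeroξ s (by rw [heq s, hs, mul_zero])
      have hF₂box : ∀ s, F₂ s = 0 → 1 - δ < s.re → δ ≤ |s.im| := by
        intro s hs h1
        by_contra h2; rw [not_le] at h2
        have hξs : ξ s = 0 := by rw [heq s, hs, mul_zero]
        obtain ⟨hζs, hsbox⟩ := hξbox s hξs h1 h2
        -- uniqueness: `s = ρ₀ = β₀`
        have hsρ : s = ρ₀ := hsub ⟨hζs, hsbox⟩ ⟨hρ₀, hρ₀box⟩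
        rw [hsρ, hρ₀eq] at hs
        -- then `ord_{β₀} ξ ≥ 2`
        have hPan : AnalyticAt ℂ (fun z : ℂ ↦ (z - β₀) * (z - ((1 - β₀ : ℝ) : ℂ))) (β₀ : ℂ) := by fun_prop
        have hF₂an : AnalyticAt ℂ F₂ (β₀ : ℂ) := hF₂.analyticAt _
        have hξfun : ξ = fun z ↦ (z - β₀) * (z - ((1 - β₀ : ℝ) : ℂ)) * F₂ z := funext heq'
        have h2 : (2 : ℕ∞) ≤ analyticOrderAt ξ (β₀ : ℂ) := by
          rw [hξfun, show (fun z ↦ (z - ↑β₀) * (z - ↑(1 - β₀ : ℝ)) * F₂ z) =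
            (fun z : ℂ ↦ (z - β₀) * (z - ((1 - β₀ : ℝ) : ℂ))) * F₂ from rfl,
            analyticOrderAt_mul hPan hF₂an]
          have hP1 : (1 : ℕ∞) ≤ analyticOrderAt (fun z : ℂ ↦ (z - β₀) * (z - ((1 - β₀ : ℝ) : ℂ))) (β₀ : ℂ) := by
            rw [Order.one_le_iff_ne_zero, ne_eq, hPan.analyticOrderAt_eq_zero]
            simp
          have hF1 : (1 : ℕ∞) ≤ analyticOrderAt F₂ (β₀ : ℂ) := by
            rw [Order.one_le_iff_ne_zero, ne_eq, hF₂an.analyticOrderAt_eq_zero]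
            simpa using hs
          calc (2 : ℕ∞) = 1 + 1 := by norm_num
            _ ≤ _ := add_le_add hP1 hF1
        rw [hordξ] at h2
        exact absurd h2 (by norm_num)
      -- `F₂` does not vanish on `[1, ∞)`
      have hF₂ne : ∀ t : ℝ, 1 ≤ t → F₂ t ≠ 0 := by
        intro t ht h0
        have h1 := hF₂zero _ h0
        have h2 := hF₂box _ h0 (by simp; linarith)
        simp at h2; linarith
      -- the comparison and the integration
      have hcomp : ∀ t : ℝ, 1 < t → t < σ₁ → (deriv F₂ t / F₂ t).re ≤ 4 * (logDeriv F₂ σ₁).re := by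
        intro t ht1 ht2
        have := re_logDeriv_le_four_mul hF₂ hF₂symm (by norm_num : (15 / 8 : ℝ) < 2) (by norm_num) hC₂
          hF₂zero hδ0 (by linarith) hF₂box ht1 ht2.le (le_refl _)
        rwa [logDeriv_apply] at this
      have hint := log_norm_sub_le hF₂ hσ₁1.le (fun t ht _ ↦ hF₂ne t ht) hcomp
      rw [Complex.ofReal_one] at hint
      -- `Re F₂'/F₂(σ₁) ≤ Re ξ'/ξ(σ₁) ≤ 1/δ + L/2`
      have hPσ₁ : ((σ₁ : ℂ) - β₀) * ((σ₁ : ℂ) - ((1 - β₀ : ℝ) : ℂ)) ≠ 0 := by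
        apply mul_ne_zero
        · intro h; have := congrArg Complex.re h; simp at this; linarith
        · intro h; have := congrArg Complex.re h; simp at this; linarith
      have hF₂σ₁ : F₂ σ₁ ≠ 0 := hF₂ne σ₁ hσ₁1.le
      have hlogsplit : logDeriv ξ σ₁ = logDeriv (fun z : ℂ ↦ (z - β₀) * (z - ((1 - β₀ : ℝ) : ℂ))) σ₁ +
          logDeriv F₂ σ₁ := by
        have hξfun : ξ = fun z ↦ (z - β₀) * (z - ((1 - β₀ : ℝ) : ℂ)) * F₂ z := funext heq'
        rw [hξfun]
        exact logDeriv_mul (f := fun z : ℂ ↦ (z - β₀) * (z - ((1 - β₀ : ℝ) : ℂ))) (g := F₂) (σ₁ : ℂ)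
          hPσ₁ hF₂σ₁ (by fun_prop) (hF₂ _)
      have hPlog : 0 ≤ (logDeriv (fun z : ℂ ↦ (z - β₀) * (z - ((1 - β₀ : ℝ) : ℂ))) σ₁).re := by
        rw [logDeriv_mul (f := fun z : ℂ ↦ z - β₀) (g := fun z : ℂ ↦ z - ((1 - β₀ : ℝ) : ℂ)) (σ₁ : ℂ)
          (by intro h; have := congrArg Complex.re h; simp at this; linarith)
          (by intro h; have := congrArg Complex.re h; simp at this; linarith) (by fun_prop) (by fun_prop)]
        have e1 : logDeriv (fun z : ℂ ↦ z - β₀) σ₁ = ((1 / (σ₁ - β₀) : ℝ) : ℂ) := by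
          rw [logDeriv_apply, deriv_sub_const, deriv_id'']; push_cast; ring
        have e2 : logDeriv (fun z : ℂ ↦ z - ((1 - β₀ : ℝ) : ℂ)) σ₁ = ((1 / (σ₁ - (1 - β₀)) : ℝ) : ℂ) := by
          rw [logDeriv_apply, deriv_sub_const, deriv_id'']; push_cast; ring
        rw [e1, e2, add_re, ofReal_re, ofReal_re]
        have : 0 < σ₁ - β₀ := by linarith
        have : 0 < σ₁ - (1 - β₀) := by linarith
        positivity
      have hF₂' : (logDeriv F₂ σ₁).re ≤ 1 / δ + L / 2 := by
        have := congrArg Complex.re hlogsplit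
        rw [add_re] at this
        linarith [hξ'σ₁, h1δ]
      -- `log ‖F₂ σ₁‖ − log ‖F₂ 1‖ ≤ 4 (1/δ + L/2) δ = 9/2`
      have hgap : Real.log ‖F₂ σ₁‖ - Real.log ‖F₂ 1‖ ≤ 9 / 2 := by
        have hσδ : σ₁ - 1 = δ := by rw [hσ₁]; ring
        have h1 : 4 * (logDeriv F₂ ↑σ₁).re * (σ₁ - 1) ≤ 9 / 2 := by
          rw [hσδ]
          have h3 : 4 * (logDeriv F₂ ↑σ₁).re * δ ≤ 4 * (1 / δ + L / 2) * δ :=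
            mul_le_mul_of_nonneg_right (by linarith) hδ0.le
          have h2 : 4 * (1 / δ + L / 2) * δ = 4 + 2 * (δ * L) := by field_simp; ring
          rw [h2, hδL] at h3
          linarith
        linarith [hint]
      have hF₂1pos : 0 < ‖F₂ 1‖ := norm_pos_iff.mpr (by simpa using hF₂ne 1 le_rfl)
      have hF₂σ₁pos : 0 < ‖F₂ σ₁‖ := norm_pos_iff.mpr hF₂σ₁
      have hratio : Real.exp (-9 / 2) * ‖F₂ σ₁‖ ≤ ‖F₂ 1‖ := by
        have : Real.log (Real.exp (-9 / 2) * ‖F₂ σ₁‖) ≤ Real.log ‖F₂ 1‖ := by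
          rw [Real.log_mul (Real.exp_pos _).ne' hF₂σ₁pos.ne', Real.log_exp]; linarith
        exact (Real.log_le_log_iff (by positivity) hF₂1pos).mp this
      -- unpack `ξ(1) = β₀(1−β₀) F₂(1)`, `ξ(σ₁) = (σ₁−β₀)(σ₁−1+β₀) F₂(σ₁)`
      have hξ1' : ‖ξ 1‖ = (1 - β₀) * β₀ * ‖F₂ 1‖ := by
        rw [heq' 1, norm_mul, norm_mul, show (1 : ℂ) - (β₀ : ℂ) = ((1 - β₀ : ℝ) : ℂ) by push_cast; ring,
          show (1 : ℂ) - ((1 - β₀ : ℝ) : ℂ) = (β₀ : ℂ) by push_cast; ring, Complex.norm_real, Complex.norm_real,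
          Real.norm_of_nonneg (by linarith), Real.norm_of_nonneg hβ₀pos.le]
      have hξσ₁' : ‖ξ σ₁‖ = (σ₁ - β₀) * (σ₁ - (1 - β₀)) * ‖F₂ σ₁‖ := by
        rw [heq' σ₁, norm_mul, norm_mul, show (σ₁ : ℂ) - (β₀ : ℂ) = ((σ₁ - β₀ : ℝ) : ℂ) by push_cast; ring,
          show (σ₁ : ℂ) - ((1 - β₀ : ℝ) : ℂ) = ((σ₁ - (1 - β₀) : ℝ) : ℂ) by push_cast; ring, Complex.norm_real,
          Complex.norm_real, Real.norm_of_nonneg (by linarith), Real.norm_of_nonneg (by linarith)]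
      rw [hξ1', hξσ₁']
      -- numerics: `σ₁ − β₀ ≤ 2δ`, `σ₁ − (1 − β₀) ≤ σ₁ ≤ 5/4`, `β₀ ≥ 3/4`, `c/L ≤ 1 − β₀`
      have hA : σ₁ - β₀ ≤ 2 * δ := by rw [hσ₁]; linarith
      have hB : σ₁ - (1 - β₀) ≤ 5 / 4 := by rw [hσ₁]; linarith
      have hβ34 : 3 / 4 ≤ β₀ := by linarith
      have hcL0 : 0 ≤ c / L := by positivity
      have he0 : 0 < Real.exp (-9 / 2) := Real.exp_pos _
      have hX : (σ₁ - β₀) * (σ₁ - (1 - β₀)) ≤ 2 * δ * (5 / 4) :=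
        mul_le_mul hA hB (by linarith) (by linarith)
      calc 3 / 10 * Real.exp (-9 / 2) * (c / L) / δ * ((σ₁ - β₀) * (σ₁ - (1 - β₀)) * ‖F₂ ↑σ₁‖)
          ≤ 3 / 10 * Real.exp (-9 / 2) * (c / L) / δ * ((2 * δ * (5 / 4)) * ‖F₂ ↑σ₁‖) := by
            apply mul_le_mul_of_nonneg_left (mul_le_mul_of_nonneg_right hX hF₂σ₁pos.le)
            positivity
        _ = 3 / 4 * (c / L) * (Real.exp (-9 / 2) * ‖F₂ ↑σ₁‖) := by field_simp; ring
        _ ≤ 3 / 4 * (c / L) * ‖F₂ 1‖ := mul_le_mul_of_nonneg_left hratio (by positivity)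
        _ ≤ (1 - β₀) * β₀ * ‖F₂ 1‖ := by
            apply mul_le_mul_of_nonneg_right _ hF₂1pos.le
            nlinarith
    · -- CASE (i): no zero of `ζ₁_K` in Stark's box; `F₂ = ξ`
      push Not at hex
      have hξboxfree : ∀ s, ξ s = 0 → 1 - δ < s.re → δ ≤ |s.im| := by
        intro s hs h1
        by_contra h2; rw [not_le] at h2
        obtain ⟨hζs, hsbox⟩ := hξbox s hs h1 h2
        exact hex s hζs hsbox
      have hξne : ∀ t : ℝ, 1 ≤ t → ξ t ≠ 0 := by
        intro t ht h0
        have h1 := hzeroξ _ h0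
        have h2 := hξboxfree _ h0 (by simp; linarith)
        simp at h2; linarith
      have hcomp : ∀ t : ℝ, 1 < t → t < σ₁ → (deriv ξ t / ξ t).re ≤ 4 * (logDeriv ξ σ₁).re := by
        intro t ht1 ht2
        have := re_logDeriv_le_four_mul hdiff hsymm (by norm_num : (15 / 8 : ℝ) < 2) (by norm_num) hC'
          hzeroξ hδ0 (by linarith) hξboxfree ht1 ht2.le (le_refl _)
        rwa [logDeriv_apply] at this
      have hint := log_norm_sub_le hdiff hσ₁1.le (fun t ht _ ↦ hξne t ht) hcomp
      rw [Complex.ofReal_one] at hint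
      have hgap : Real.log ‖ξ σ₁‖ - Real.log ‖ξ 1‖ ≤ 9 / 2 := by
        have hσδ : σ₁ - 1 = δ := by rw [hσ₁]; ring
        have h1 : 4 * (logDeriv ξ ↑σ₁).re * (σ₁ - 1) ≤ 9 / 2 := by
          rw [hσδ]
          have h3 : 4 * (logDeriv ξ ↑σ₁).re * δ ≤ 4 * (1 / δ + L / 2) * δ :=
            mul_le_mul_of_nonneg_right (by linarith [hξ'σ₁, h1δ]) hδ0.le
          have h2 : 4 * (1 / δ + L / 2) * δ = 4 + 2 * (δ * L) := by field_simp; ring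
          rw [h2, hδL] at h3
          linarith
        linarith [hint]
      have hξ1pos : 0 < ‖ξ 1‖ := norm_pos_iff.mpr (by simpa using hξne 1 le_rfl)
      have hξσ₁pos : 0 < ‖ξ σ₁‖ := norm_pos_iff.mpr (hξne σ₁ hσ₁1.le)
      have hratio : Real.exp (-9 / 2) * ‖ξ σ₁‖ ≤ ‖ξ 1‖ := by
        have : Real.log (Real.exp (-9 / 2) * ‖ξ σ₁‖) ≤ Real.log ‖ξ 1‖ := by
          rw [Real.log_mul (Real.exp_pos _).ne' hξσ₁pos.ne', Real.log_exp]; linarith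
        exact (Real.log_le_log_iff (by positivity) hξ1pos).mp this
      -- `(3/10)(c/L)/δ ≤ 1` since `c ≤ 1/4` and `1/δ = 4L`
      have hsmall : 3 / 10 * Real.exp (-9 / 2) * (c / L) / δ ≤ Real.exp (-9 / 2) := by
        have h1 : (c / L) / δ = 4 * c := by rw [hδ]; field_simp
        rw [mul_div_assoc, h1]
        nlinarith [Real.exp_pos (-9 / 2 : ℝ)]
      calc 3 / 10 * Real.exp (-9 / 2) * (c / L) / δ * ‖ξ ↑σ₁‖ ≤ Real.exp (-9 / 2) * ‖ξ σ₁‖ :=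
            mul_le_mul_of_nonneg_right hsmall hξσ₁pos.le
        _ ≤ ‖ξ 1‖ := hratio
  -- conclusion: `κ ‖γ(1)‖ = ‖ξ 1‖ ≥ (3/10)e^{-9/2}(c/L)/δ · δ · 16^{-n} ‖γ(1)‖`
  have hchain : 3 / 10 * Real.exp (-9 / 2) * (c / L) * (E * ‖dedekindGammaFactor K 1‖) ≤
      dedekindZeta_residue K * ‖dedekindGammaFactor K 1‖ := by
    rw [← hξ1]
    calc 3 / 10 * Real.exp (-9 / 2) * (c / L) * (E * ‖dedekindGammaFactor K 1‖)
        ≤ 3 / 10 * Real.exp (-9 / 2) * (c / L) * ‖dedekindGammaFactor K σ₁‖ :=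
          mul_le_mul_of_nonneg_left hγ (by positivity)
      _ = 3 / 10 * Real.exp (-9 / 2) * (c / L) / δ * (δ * ‖dedekindGammaFactor K σ₁‖) := by
          field_simp
      _ ≤ 3 / 10 * Real.exp (-9 / 2) * (c / L) / δ * ‖ξ σ₁‖ :=
          mul_le_mul_of_nonneg_left hξσ₁ (by positivity)
      _ ≤ ‖ξ 1‖ := hmain
  have hfin : 3 / 10 * Real.exp (-9 / 2) * (c / L) * E ≤ dedekindZeta_residue K := by
    have := le_of_mul_le_mul_right (by linarith [hchain] :
      3 / 10 * Real.exp (-9 / 2) * (c / L) * E * ‖dedekindGammaFactor K 1‖ ≤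
        dedekindZeta_residue K * ‖dedekindGammaFactor K 1‖) hγ1pos
    exact this
  calc Real.exp (-7) * E * (c / L) ≤ 3 / 10 * Real.exp (-9 / 2) * E * (c / L) := by
        apply mul_le_mul_of_nonneg_right (mul_le_mul_of_nonneg_right exp_neg_seven_le hE0.le) (by positivity)
    _ = 3 / 10 * Real.exp (-9 / 2) * (c / L) * E := by ring
    _ ≤ dedekindZeta_residue K := hfin

end Residue

end Summit.QuantumAdvantage.QuantumAdvantage.Theorems.DegreeOnePrimesEscape

end
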